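import Summits.Ventures.LatticeQCDFlow.Scaling.ParallelTemperingHalfSweepLadder

/-!
HONEST FRAMING: exact (Metropolis-corrected) sampling algorithms for lattice gauge theory; figures
of merit are autocorrelation/cost numbers at stated couplings and volumes; no continuum-physics
claim.

# ParallelTemperingHalfSweepTauInt — PTBC WITH HALF-SWEEPS OF SWAPS IN RANDOM SCAN: THE EXACT TAG LAW
# `ρ_τ(1) = 1 − 3tā_K/(K(K+2))`, THE REPLICA-NUMBER-FREE LAWS `ρ_τ(1) ≥ 1 − 24/(e·m·(b−a)²)` (SCAN) AND
# `≥ 1 − 24t/(e·m·(b−a)²)` (RANDOM SCAN), AND `τ_int(tag) ≥ K(K+2)/(3tā_K) − ½ ≥ e·m·(b−a)²/(24t) − ½` FOR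
# REVERSIBLE REPLICA UPDATES (lean-2 GEN-15, ours)

Venture-side (OURS).  Cell `lqcd-flow` (pub-lqcd), unit `pub-lqcd-lean-2-g15`, 2026-08-24.  Third file of the
half-sweep chapter (`Scaling/ParallelTemperingHalfSweep`, `…HalfSweepLadder`).  The random-scan PTBC sampler
`t·H + (1−t)·M` — with probability `t` a random-parity half-sweep `H` of swap attempts, else the replica update `M` —
is reversible whenever `M` is (e.g. GEN-14's `ptRandomUpdate` of reversible single-replica kernels, or perfect
redraws), so row 8's Madras–Slade floor (`Scaling/TemperingLevelTauInt.level_tauInt_ge`) turns the EXACT move rate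
`(t/2)·ā_K` into a floor on the integrated autocorrelation time of the tagged replica's level.

## What is proved (`X` bounded measurable, `μ` a probability measure, `K ≥ 1`)

* §1 `ptHalfMix t M = mixtureKernel t H M`: (i) `ptHalfMix_invariant`, (ii) `ptHalfMix_nearestNeighbour`,
  (iii) **`ptHalfMix_real_moves_eq`** (`= (t/2)·ptSwapRatio`, exact), `ptHalfMix_isReversible` (`M` reversible),
  `ptHalfMix_moveRate_eq` (`(t/2)·ā_K`), **`ptHalfMix_level_lagOneAutocorr_eq`**: `ρ_τ(1) = 1 − 3tā_K/(K(K+2))`.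
* §2 uniform ladder on `[a,b]`, floor `0 < m ≤ Var_{μ_u}(X)`: **`ptHalfScan_level_lagOneAutocorr_ge_kfree`**
  (`Mk ∘ₖ H`: `1 − 24/(e·m·(b−a)²) ≤ ρ_τ(1)` for EVERY number of replicas) and
  **`ptHalfMix_level_lagOneAutocorr_ge_kfree`** (`1 − 24t/(e·m·(b−a)²) ≤ ρ_τ(1)`).
* §3 `M` REVERSIBLE, summable tag autocorrelations with `ρ(1) < 1`: **`ptHalfMix_level_tauInt_ge`**
  (`K(K+2)/(3tā_K) − ½ ≤ τ_int(tag)`, any ladder) and **`ptHalfMix_level_tauInt_ge_kfree`**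
  (`e·m·(b−a)²/(24t) − ½ ≤ τ_int(tag)` on the uniform ladder, every `K`).

NOT CLAIMED: the summability / `ρ(1) < 1` provisos (hypotheses); deterministic alternation `O ∘ₖ E`; anything
measured.  Literature grade (cell rule): TEXTBOOK ALGORITHM + KNOWN MECHANISM (diffusive ladder motion; Madras–Slade
1993 reversible-chain floor via row 8), NEW TYPING; nothing cited as a fact; no new bib keys.
-/

noncomputable section

open MeasureTheory ProbabilityTheory Set Filter Finset
open Summit.Ventures.LatticeQCDFlow.Exactness Summit.Ventures.LatticeQCDFlow.Scoring
open scoped ENNReal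

namespace Summit.Ventures.LatticeQCDFlow.Scaling

/-! ## §1 The random-scan sampler `t·H + (1−t)·M` -/

section Mix

variable {Ω : Type*} [MeasurableSpace Ω] {X : Ω → ℝ} {μ : Measure Ω} [IsProbabilityMeasure μ]
  {β : ℕ → ℝ} {K : ℕ}

/-- **THE RANDOM-SCAN PTBC SAMPLER**: with probability `t` a random-parity half-sweep of swap attempts, else the
replica update `M`. [ours] -/
def ptHalfMix {X : Ω → ℝ} (hXm : Measurable X) (β : ℕ → ℝ) (K : ℕ) (t : unitInterval)
    (M : Kernel (Fin (K + 1) × (Fin (K + 1) → Ω)) (Fin (K + 1) × (Fin (K + 1) → Ω))) :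
    Kernel (Fin (K + 1) × (Fin (K + 1) → Ω)) (Fin (K + 1) × (Fin (K + 1) → Ω)) :=
  mixtureKernel t (ptHalfSweep hXm β K) M

omit [IsProbabilityMeasure μ] in
/-- The random-scan sampler is Markov (for Markov `M`). [ours] -/
instance isMarkovKernel_ptHalfMix (hXm : Measurable X) (t : unitInterval)
    (M : Kernel (Fin (K + 1) × (Fin (K + 1) → Ω)) (Fin (K + 1) × (Fin (K + 1) → Ω))) [IsMarkovKernel M] :
    IsMarkovKernel (ptHalfMix hXm β K t M) := by
  unfold ptHalfMix; infer_instance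

/-- (i) `t·H + (1−t)·M` leaves the tagged target invariant if `M` does. [ours] -/
theorem ptHalfMix_invariant (hXm : Measurable X) (hXb : ∃ C, ∀ x, |X x| ≤ C) (t : unitInterval)
    (M : Kernel (Fin (K + 1) × (Fin (K + 1) → Ω)) (Fin (K + 1) × (Fin (K + 1) → Ω)))
    (hMinv : Kernel.Invariant M (ptTaggedTarget X μ β K)) :
    Kernel.Invariant (ptHalfMix hXm β K t M) (ptTaggedTarget X μ β K) :=
  invariant_mixtureKernel t (invariant_ptHalfSweep hXm hXb) hMinv

omit [IsProbabilityMeasure μ] in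
/-- (ii) `t·H + (1−t)·M` moves the tag by at most one level (`M` tag-preserving). [ours] -/
theorem ptHalfMix_nearestNeighbour (hXm : Measurable X) (t : unitInterval)
    (M : Kernel (Fin (K + 1) × (Fin (K + 1) → Ω)) (Fin (K + 1) × (Fin (K + 1) → Ω)))
    (hM : ∀ y, M y {y' | ((y'.1 : Fin (K + 1)) : ℕ) ≠ ((y.1 : Fin (K + 1)) : ℕ)} = 0)
    (z : Fin (K + 1) × (Fin (K + 1) → Ω)) :
    ∀ᵐ y ∂(ptHalfMix hXm β K t M z), |(((y.1 : Fin (K + 1)) : ℕ) : ℝ) - ((z.1 : Fin (K + 1)) : ℕ)| ≤ 1 := by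
  rw [ae_iff]
  unfold ptHalfMix
  refine mixtureKernel_null t _ _ z (ae_iff.1 (ptHalfSweep_nearestNeighbour hXm z)) ?_
  refine measure_mono_null (fun y hy => ?_) (hM z)
  intro h
  apply hy
  show |(((y.1 : Fin (K + 1)) : ℕ) : ℝ) - ((z.1 : Fin (K + 1)) : ℕ)| ≤ 1
  rw [h, sub_self, abs_zero]; exact zero_le_one

omit [IsProbabilityMeasure μ] in
/-- **(iii) THE EXACT TAG-MOVE PROBABILITY of `t·H + (1−t)·M` is `(t/2)·ptSwapRatio`** (`M` tag-preserving Markov).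
[ours] -/
theorem ptHalfMix_real_moves_eq (hXm : Measurable X) (t : unitInterval)
    (M : Kernel (Fin (K + 1) × (Fin (K + 1) → Ω)) (Fin (K + 1) × (Fin (K + 1) → Ω))) [IsMarkovKernel M]
    (hM : ∀ y, M y {y' | ((y'.1 : Fin (K + 1)) : ℕ) ≠ ((y.1 : Fin (K + 1)) : ℕ)} = 0)
    (z : Fin (K + 1) × (Fin (K + 1) → Ω)) :
    (ptHalfMix hXm β K t M z).real {y | ((y.1 : Fin (K + 1)) : ℕ) ≠ ((z.1 : Fin (K + 1)) : ℕ)} =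
      (t : ℝ) / 2 * ptSwapRatio X β K z := by
  unfold ptHalfMix
  rw [mixtureKernel_real, ptHalfSweep_real_moves_eq hXm z]
  have hW : (M z).real {y | ((y.1 : Fin (K + 1)) : ℕ) ≠ ((z.1 : Fin (K + 1)) : ℕ)} = 0 := by
    rw [measureReal_def, hM z, ENNReal.toReal_zero]
  rw [hW, mul_zero, add_zero]
  ring

omit [IsProbabilityMeasure μ] in
/-- It moves the tag with probability at most `ptSwapRatio`. [ours] -/
theorem ptHalfMix_real_moves_le (hXm : Measurable X) (t : unitInterval)
    (M : Kernel (Fin (K + 1) × (Fin (K + 1) → Ω)) (Fin (K + 1) × (Fin (K + 1) → Ω))) [IsMarkovKernel M]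
    (hM : ∀ y, M y {y' | ((y'.1 : Fin (K + 1)) : ℕ) ≠ ((y.1 : Fin (K + 1)) : ℕ)} = 0)
    (z : Fin (K + 1) × (Fin (K + 1) → Ω)) :
    (ptHalfMix hXm β K t M z).real {y | ((y.1 : Fin (K + 1)) : ℕ) ≠ ((z.1 : Fin (K + 1)) : ℕ)} ≤
      ptSwapRatio X β K z := by
  rw [ptHalfMix_real_moves_eq hXm t M hM z]
  have h0 := ptSwapRatio_nonneg (X := X) (β := β) z
  have ht0 : (0 : ℝ) ≤ t := t.2.1
  have ht1 : (t : ℝ) ≤ 1 := t.2.2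
  nlinarith

/-- **Detailed balance of the random-scan sampler**: `M` reversible ⇒ `t·H + (1−t)·M` reversible. [ours] -/
theorem ptHalfMix_isReversible (hXm : Measurable X) (hXb : ∃ C, ∀ x, |X x| ≤ C) (t : unitInterval)
    (M : Kernel (Fin (K + 1) × (Fin (K + 1) → Ω)) (Fin (K + 1) × (Fin (K + 1) → Ω)))
    (hMrev : Kernel.IsReversible M (ptTaggedTarget X μ β K)) :
    Kernel.IsReversible (ptHalfMix hXm β K t M) (ptTaggedTarget X μ β K) :=
  isReversible_mixtureKernel t (isReversible_ptHalfSweep hXm hXb) hMrev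

/-- **The stationary tag-move rate of the random-scan sampler is `(t/2)·ā_K`.** [ours] -/
theorem ptHalfMix_moveRate_eq (hXm : Measurable X) (hXb : ∃ C, ∀ x, |X x| ≤ C) (t : unitInterval)
    (M : Kernel (Fin (K + 1) × (Fin (K + 1) → Ω)) (Fin (K + 1) × (Fin (K + 1) → Ω))) [IsMarkovKernel M]
    (hM : ∀ y, M y {y' | ((y'.1 : Fin (K + 1)) : ℕ) ≠ ((y.1 : Fin (K + 1)) : ℕ)} = 0) :
    ∫ z, (ptHalfMix hXm β K t M z).real {y | ((y.1 : Fin (K + 1)) : ℕ) ≠ ((z.1 : Fin (K + 1)) : ℕ)}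
        ∂(ptTaggedTarget X μ β K) =
      (t : ℝ) / 2 * (2 / (K + 1) * ∑ j : Fin K, swapAcc X μ (β (j : ℕ)) (β ((j : ℕ) + 1))) := by
  simp only [ptHalfMix_real_moves_eq hXm t M hM]
  rw [integral_const_mul, pt_moveRate_eq hXm hXb]

/-- **EXACT TAG LAW OF THE RANDOM-SCAN PTBC SAMPLER** (`K ≥ 1`, `M` tag-preserving, target-invariant Markov):
`ρ_τ(1) = 1 − 3t·ā_K/(K(K+2))`. [ours] -/
theorem ptHalfMix_level_lagOneAutocorr_eq (hXm : Measurable X) (hXb : ∃ C, ∀ x, |X x| ≤ C) (hK : 1 ≤ K)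
    (t : unitInterval) (M : Kernel (Fin (K + 1) × (Fin (K + 1) → Ω)) (Fin (K + 1) × (Fin (K + 1) → Ω)))
    [IsMarkovKernel M] (hMinv : Kernel.Invariant M (ptTaggedTarget X μ β K))
    (hM : ∀ y, M y {y' | ((y'.1 : Fin (K + 1)) : ℕ) ≠ ((y.1 : Fin (K + 1)) : ℕ)} = 0) :
    (autocov (ptHalfMix hXm β K t M) (ptTaggedTarget X μ β K) (fun z => (((z.1 : Fin (K + 1)) : ℕ) : ℝ)) 1 -
        ((K : ℝ) / 2) ^ 2) / (K * (K + 2) / 12) =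
      1 - 3 * (t : ℝ) * (2 / (K + 1) * ∑ j : Fin K, swapAcc X μ (β (j : ℕ)) (β ((j : ℕ) + 1))) / (K * (K + 2)) := by
  haveI := isProbabilityMeasure_ptTaggedTarget (μ := μ) (β := β) (K := K) hXm hXb
  rw [level_lagOneAutocorr_eq (lev := fun z : Fin (K + 1) × (Fin (K + 1) → Ω) => ((z.1 : Fin (K + 1)) : ℕ))
    (ptHalfMix_invariant hXm hXb t M hMinv) measurable_ptLevel (fun z => Nat.le_of_lt_succ z.1.isLt) hK
    (fun k hk => ptTaggedTarget_real_level hXm hXb k hk) (ptHalfMix_nearestNeighbour hXm t M hM),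
    ptHalfMix_moveRate_eq hXm hXb t M hM]
  ring

end Mix

/-! ## §2 The replica-number-free laws per half-sweep -/

section KFree

variable {Ω : Type*} [MeasurableSpace Ω] {X : Ω → ℝ} {μ : Measure Ω} [IsProbabilityMeasure μ] {K : ℕ}

omit [MeasurableSpace Ω] [IsProbabilityMeasure μ] in
/-- `6·e^{−A/K²}/((K+1)(K+2)) ≤ 6/(e·A)` for `A > 0`, `K ≥ 1` (half of GEN-13's `ladder_rate_kfree`). [ours] -/
theorem half_ladder_rate_kfree {A K : ℝ} (hA : 0 < A) (hK : 1 ≤ K) :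
    6 * Real.exp (-(A / K ^ 2)) / ((K + 1) * (K + 2)) ≤ 6 / (Real.exp 1 * A) := by
  have h := ladder_rate_kfree hA hK
  have e1 : 6 * Real.exp (-(A / K ^ 2)) / ((K + 1) * (K + 2)) =
      (12 * Real.exp (-(A / K ^ 2)) / ((K + 1) * (K + 2))) / 2 := by
    ring
  have e2 : 6 / (Real.exp 1 * A) = (12 / (Real.exp 1 * A)) / 2 := by ring
  rw [e1, e2]
  linarith

/-- **REPLICA-NUMBER-FREE LAW PER HALF-SWEEP**: on the uniform ladder from `a` to `b > a` with a variance floor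
`0 < m ≤ Var_{μ_u}(X)` on `[a,b]`, the PTBC sampler `Mk ∘ₖ H` (`Mk` any tag-preserving Markov replica update) has
`1 − 24/(e·m·(b−a)²) ≤ ρ_τ(1)` for EVERY number of replicas (`K ≥ 1`). [ours] -/
theorem ptHalfScan_level_lagOneAutocorr_ge_kfree (hXm : Measurable X) (hXb : ∃ C, ∀ x, |X x| ≤ C) {a b m : ℝ}
    (hab : a < b) (hm0 : 0 < m) (hm : ∀ u ∈ Icc a b, m ≤ variance X (μ.tilted fun x => u * X x)) (hK : 1 ≤ K)
    (Mk : Kernel (Fin (K + 1) × (Fin (K + 1) → Ω)) (Fin (K + 1) × (Fin (K + 1) → Ω))) [IsMarkovKernel Mk]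
    (hMk : ∀ y, Mk y {y' | ((y'.1 : Fin (K + 1)) : ℕ) ≠ ((y.1 : Fin (K + 1)) : ℕ)} = 0) :
    1 - 24 / (Real.exp 1 * m * (b - a) ^ 2) ≤
      (autocov (Mk ∘ₖ ptHalfSweep hXm (fun k => a + k * ((b - a) / K)) K)
          (ptTaggedTarget X μ (fun k => a + k * ((b - a) / K)) K)
          (fun z => (((z.1 : Fin (K + 1)) : ℕ) : ℝ)) 1 - ((K : ℝ) / 2) ^ 2) / (K * (K + 2) / 12) := by
  have h := ptHalfScan_one_sub_lagOneAutocorr_le (μ := μ) hXm hXb hab.le hm hK Mk hMk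
  have hKr : (1 : ℝ) ≤ K := by exact_mod_cast hK
  have hA : 0 < m * (b - a) ^ 2 / 4 := by
    have : 0 < (b - a) ^ 2 := by nlinarith
    positivity
  have hk := half_ladder_rate_kfree hA hKr
  have e1 : -(m * (b - a) ^ 2 / 4 / (K : ℝ) ^ 2) = -(m * (b - a) ^ 2 / (4 * K ^ 2)) := by
    rw [div_div]
  rw [e1] at hk
  have e2 : 6 / (Real.exp 1 * (m * (b - a) ^ 2 / 4)) = 24 / (Real.exp 1 * m * (b - a) ^ 2) := by
    field_simp
    ring
  rw [e2] at hk
  linarith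

/-- **REPLICA-NUMBER-FREE LAW, random scan**: `1 − 24t/(e·m·(b−a)²) ≤ ρ_τ(1)` for `t·H + (1−t)·M`, every `K ≥ 1`,
every `t`, every tag-preserving exact Markov `M`. [ours] -/
theorem ptHalfMix_level_lagOneAutocorr_ge_kfree (hXm : Measurable X) (hXb : ∃ C, ∀ x, |X x| ≤ C) {a b m : ℝ}
    (hab : a < b) (hm0 : 0 < m) (hm : ∀ u ∈ Icc a b, m ≤ variance X (μ.tilted fun x => u * X x)) (hK : 1 ≤ K)
    (t : unitInterval) (M : Kernel (Fin (K + 1) × (Fin (K + 1) → Ω)) (Fin (K + 1) × (Fin (K + 1) → Ω)))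
    [IsMarkovKernel M] (hMinv : Kernel.Invariant M (ptTaggedTarget X μ (fun k => a + k * ((b - a) / K)) K))
    (hM : ∀ y, M y {y' | ((y'.1 : Fin (K + 1)) : ℕ) ≠ ((y.1 : Fin (K + 1)) : ℕ)} = 0) :
    1 - 24 * (t : ℝ) / (Real.exp 1 * m * (b - a) ^ 2) ≤
      (autocov (ptHalfMix hXm (fun k => a + k * ((b - a) / K)) K t M)
          (ptTaggedTarget X μ (fun k => a + k * ((b - a) / K)) K)
          (fun z => (((z.1 : Fin (K + 1)) : ℕ) : ℝ)) 1 - ((K : ℝ) / 2) ^ 2) / (K * (K + 2) / 12) := by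
  rw [ptHalfMix_level_lagOneAutocorr_eq (β := fun k => a + k * ((b - a) / K)) hXm hXb hK t M hMinv hM]
  -- the scan law with `Mk := Kernel.id` gives the bound on `3ā_K/(K(K+2))`
  have hid : ∀ y : Fin (K + 1) × (Fin (K + 1) → Ω), (Kernel.id : Kernel (Fin (K + 1) × (Fin (K + 1) → Ω))
      (Fin (K + 1) × (Fin (K + 1) → Ω))) y {y' | ((y'.1 : Fin (K + 1)) : ℕ) ≠ ((y.1 : Fin (K + 1)) : ℕ)} = 0 := by
    intro y
    rw [Kernel.id_apply, Measure.dirac_apply' _ (measurableSet_tagMoved y)]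
    simp
  have h := ptHalfScan_level_lagOneAutocorr_ge_kfree (μ := μ) hXm hXb hab hm0 hm hK Kernel.id hid
  rw [ptHalfScan_level_lagOneAutocorr_eq (β := fun k => a + k * ((b - a) / K)) hXm hXb hK Kernel.id hid] at h
  -- `h : 1 − 24/(e m (b−a)²) ≤ 1 − 3ā/(K(K+2))`; multiply the deficit by `t ∈ [0,1]`
  have ht0 : (0 : ℝ) ≤ t := t.2.1
  set A : ℝ := 2 / (K + 1) * ∑ j : Fin K, swapAcc X μ (a + (j : ℕ) * ((b - a) / K))
    (a + (((j : ℕ) + 1 : ℕ) : ℝ) * ((b - a) / K)) with hA_def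
  have h' : 3 * A / (K * (K + 2)) ≤ 24 / (Real.exp 1 * m * (b - a) ^ 2) := by linarith
  have h'' : (t : ℝ) * (3 * A / (K * (K + 2))) ≤ (t : ℝ) * (24 / (Real.exp 1 * m * (b - a) ^ 2)) :=
    mul_le_mul_of_nonneg_left h' ht0
  have e1 : 3 * (t : ℝ) * A / (K * (K + 2)) = (t : ℝ) * (3 * A / (K * (K + 2))) := by ring
  have e2 : 24 * (t : ℝ) / (Real.exp 1 * m * (b - a) ^ 2) = (t : ℝ) * (24 / (Real.exp 1 * m * (b - a) ^ 2)) := by ring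
  rw [e1, e2]
  linarith

end KFree

/-! ## §3 `τ_int` of the tagged replica's level for reversible replica updates -/

section TauInt

variable {Ω : Type*} [MeasurableSpace Ω] {X : Ω → ℝ} {μ : Measure Ω} [IsProbabilityMeasure μ]
  {β : ℕ → ℝ} {K : ℕ}

/-- **`τ_int` OF THE TAG UNDER THE RANDOM-SCAN PTBC SAMPLER, ANY LADDER**: `M` tag-preserving, target-invariant and
REVERSIBLE, `K ≥ 1`, summable tag autocorrelations with `ρ(1) < 1`:
`K(K+2)/(3t·ā_K) − ½ ≤ τ_int(tag)`, `ā_K = (2/(K+1))·Σ_j swapAcc(β_j, β_{j+1})`. [ours] -/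
theorem ptHalfMix_level_tauInt_ge (hXm : Measurable X) (hXb : ∃ C, ∀ x, |X x| ≤ C) (hK : 1 ≤ K)
    (t : unitInterval) (M : Kernel (Fin (K + 1) × (Fin (K + 1) → Ω)) (Fin (K + 1) × (Fin (K + 1) → Ω)))
    [IsMarkovKernel M] (hMinv : Kernel.Invariant M (ptTaggedTarget X μ β K))
    (hMrev : Kernel.IsReversible M (ptTaggedTarget X μ β K))
    (hM : ∀ y, M y {y' | ((y'.1 : Fin (K + 1)) : ℕ) ≠ ((y.1 : Fin (K + 1)) : ℕ)} = 0)
    (hs : Summable fun n => autocov (ptHalfMix hXm β K t M) (ptTaggedTarget X μ β K)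
        (fun z => (((z.1 : Fin (K + 1)) : ℕ) : ℝ) - K / 2) (n + 1) /
      autocov (ptHalfMix hXm β K t M) (ptTaggedTarget X μ β K) (fun z => (((z.1 : Fin (K + 1)) : ℕ) : ℝ) - K / 2) 0)
    (hρ : autocov (ptHalfMix hXm β K t M) (ptTaggedTarget X μ β K) (fun z => (((z.1 : Fin (K + 1)) : ℕ) : ℝ) - K / 2) 1 /
      autocov (ptHalfMix hXm β K t M) (ptTaggedTarget X μ β K) (fun z => (((z.1 : Fin (K + 1)) : ℕ) : ℝ) - K / 2) 0 < 1) :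
    K * (K + 2) / (3 * (t : ℝ) * (2 / (K + 1) * ∑ j : Fin K, swapAcc X μ (β (j : ℕ)) (β ((j : ℕ) + 1)))) - 1 / 2 ≤
      tauInt (fun n => autocov (ptHalfMix hXm β K t M) (ptTaggedTarget X μ β K)
          (fun z => (((z.1 : Fin (K + 1)) : ℕ) : ℝ) - K / 2) n /
        autocov (ptHalfMix hXm β K t M) (ptTaggedTarget X μ β K) (fun z => (((z.1 : Fin (K + 1)) : ℕ) : ℝ) - K / 2) 0) := by
  haveI := isProbabilityMeasure_ptTaggedTarget (μ := μ) (β := β) (K := K) hXm hXb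
  have hrm : Measurable fun z : Fin (K + 1) × (Fin (K + 1) → Ω) => (t : ℝ) / 2 * ptSwapRatio X β K z :=
    (measurable_ptSwapRatio hXm).const_mul _
  have ht0 : (0 : ℝ) ≤ t := t.2.1
  have ht1 : (t : ℝ) ≤ 1 := t.2.2
  have hr0 : ∀ z : Fin (K + 1) × (Fin (K + 1) → Ω), 0 ≤ (t : ℝ) / 2 * ptSwapRatio X β K z := fun z =>
    mul_nonneg (by positivity) (ptSwapRatio_nonneg z)
  have hrR : ∀ z : Fin (K + 1) × (Fin (K + 1) → Ω), (t : ℝ) / 2 * ptSwapRatio X β K z ≤ 2 * K := fun z => by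
    have h1 := ptSwapRatio_le (X := X) (β := β) (K := K) z
    have h2 := ptSwapRatio_nonneg (X := X) (β := β) (K := K) z
    nlinarith
  have h := level_tauInt_ge (lev := fun z : Fin (K + 1) × (Fin (K + 1) → Ω) => ((z.1 : Fin (K + 1)) : ℕ))
    (ptHalfMix_isReversible hXm hXb t M hMrev) (ptHalfMix_invariant hXm hXb t M hMinv) measurable_ptLevel
    (fun z => Nat.le_of_lt_succ z.1.isLt) hK (fun k hk => ptTaggedTarget_real_level hXm hXb k hk)
    (ptHalfMix_nearestNeighbour hXm t M hM) hrm hr0 hrR (fun z => (ptHalfMix_real_moves_eq hXm t M hM z).le) hs hρ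
  rw [integral_const_mul, pt_moveRate_eq hXm hXb] at h
  have e : 6 * ((t : ℝ) / 2 * (2 / (K + 1) * ∑ j : Fin K, swapAcc X μ (β (j : ℕ)) (β ((j : ℕ) + 1)))) =
      3 * (t : ℝ) * (2 / (K + 1) * ∑ j : Fin K, swapAcc X μ (β (j : ℕ)) (β ((j : ℕ) + 1))) := by ring
  rwa [e] at h

/-- **`τ_int` OF THE TAG, REPLICA-NUMBER-FREE (random scan with half-sweeps, reversible replica updates)**: uniform
ladder on `[a,b]`, floor `0 < m ≤ Var_{μ_u}(X)`, `M` tag-preserving, target-invariant and REVERSIBLE, `0 < t`,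
summable tag autocorrelations with `ρ(1) < 1`: `e·m·(b−a)²/(24t) − ½ ≤ τ_int(tag)` for every `K ≥ 1`. [ours] -/
theorem ptHalfMix_level_tauInt_ge_kfree (hXm : Measurable X) (hXb : ∃ C, ∀ x, |X x| ≤ C) {a b m : ℝ}
    (hab : a < b) (hm0 : 0 < m) (hm : ∀ u ∈ Icc a b, m ≤ variance X (μ.tilted fun x => u * X x)) (hK : 1 ≤ K)
    (t : unitInterval) (ht : 0 < (t : ℝ))
    (M : Kernel (Fin (K + 1) × (Fin (K + 1) → Ω)) (Fin (K + 1) × (Fin (K + 1) → Ω))) [IsMarkovKernel M]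
    (hMinv : Kernel.Invariant M (ptTaggedTarget X μ (fun k => a + k * ((b - a) / K)) K))
    (hMrev : Kernel.IsReversible M (ptTaggedTarget X μ (fun k => a + k * ((b - a) / K)) K))
    (hM : ∀ y, M y {y' | ((y'.1 : Fin (K + 1)) : ℕ) ≠ ((y.1 : Fin (K + 1)) : ℕ)} = 0)
    (hs : Summable fun n =>
      autocov (ptHalfMix hXm (fun k => a + k * ((b - a) / K)) K t M)
        (ptTaggedTarget X μ (fun k => a + k * ((b - a) / K)) K) (fun z => (((z.1 : Fin (K + 1)) : ℕ) : ℝ) - K / 2)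
        (n + 1) /
      autocov (ptHalfMix hXm (fun k => a + k * ((b - a) / K)) K t M)
        (ptTaggedTarget X μ (fun k => a + k * ((b - a) / K)) K) (fun z => (((z.1 : Fin (K + 1)) : ℕ) : ℝ) - K / 2) 0)
    (hρ : autocov (ptHalfMix hXm (fun k => a + k * ((b - a) / K)) K t M)
        (ptTaggedTarget X μ (fun k => a + k * ((b - a) / K)) K) (fun z => (((z.1 : Fin (K + 1)) : ℕ) : ℝ) - K / 2) 1 /
      autocov (ptHalfMix hXm (fun k => a + k * ((b - a) / K)) K t M)
        (ptTaggedTarget X μ (fun k => a + k * ((b - a) / K)) K) (fun z => (((z.1 : Fin (K + 1)) : ℕ) : ℝ) - K / 2) 0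
        < 1) :
    Real.exp 1 * m * (b - a) ^ 2 / (24 * (t : ℝ)) - 1 / 2 ≤
      tauInt (fun n =>
        autocov (ptHalfMix hXm (fun k => a + k * ((b - a) / K)) K t M)
          (ptTaggedTarget X μ (fun k => a + k * ((b - a) / K)) K) (fun z => (((z.1 : Fin (K + 1)) : ℕ) : ℝ) - K / 2)
          n /
        autocov (ptHalfMix hXm (fun k => a + k * ((b - a) / K)) K t M)
          (ptTaggedTarget X μ (fun k => a + k * ((b - a) / K)) K) (fun z => (((z.1 : Fin (K + 1)) : ℕ) : ℝ) - K / 2)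
          0) := by
  have h := ptHalfMix_level_tauInt_ge (β := fun k => a + k * ((b - a) / K)) hXm hXb hK t M hMinv hMrev hM hs hρ
  refine le_trans ?_ h
  -- `3ā/(K(K+2)) ≤ 24/(e m (b−a)²)` from the scan law with `Mk := id`
  have hid : ∀ y : Fin (K + 1) × (Fin (K + 1) → Ω), (Kernel.id : Kernel (Fin (K + 1) × (Fin (K + 1) → Ω))
      (Fin (K + 1) × (Fin (K + 1) → Ω))) y {y' | ((y'.1 : Fin (K + 1)) : ℕ) ≠ ((y.1 : Fin (K + 1)) : ℕ)} = 0 := by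
    intro y
    rw [Kernel.id_apply, Measure.dirac_apply' _ (measurableSet_tagMoved y)]
    simp
  have hk := ptHalfScan_level_lagOneAutocorr_ge_kfree (μ := μ) hXm hXb hab hm0 hm hK Kernel.id hid
  rw [ptHalfScan_level_lagOneAutocorr_eq (β := fun k => a + k * ((b - a) / K)) hXm hXb hK Kernel.id hid] at hk
  set A : ℝ := 2 / (K + 1) * ∑ j : Fin K, swapAcc X μ (a + (j : ℕ) * ((b - a) / K))
    (a + (((j : ℕ) + 1 : ℕ) : ℝ) * ((b - a) / K)) with hA_def
  have hApos : 0 < A := pt_abar_pos (μ := μ) (β := fun k => a + k * ((b - a) / K)) hXm hXb hK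
  have hKr : (1 : ℝ) ≤ K := by exact_mod_cast hK
  have hKK : (0 : ℝ) < K * (K + 2) := by positivity
  have hden : 0 < Real.exp 1 * m * (b - a) ^ 2 := by
    have : 0 < (b - a) ^ 2 := by nlinarith
    positivity
  -- `hk : 1 − 24/(e m (b−a)²) ≤ 1 − 3A/(K(K+2))` ⇒ `3A/(K(K+2)) ≤ 24/(e m (b−a)²)` ⇒ reciprocal comparison
  have h1 : 3 * A / (K * (K + 2)) ≤ 24 / (Real.exp 1 * m * (b - a) ^ 2) := by linarith
  have h2 : Real.exp 1 * m * (b - a) ^ 2 / 24 ≤ K * (K + 2) / (3 * A) := by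
    rw [div_le_div_iff₀ (by norm_num : (0 : ℝ) < 24) (by positivity)]
    rw [div_le_div_iff₀ hKK hden] at h1
    linarith
  have h3 : Real.exp 1 * m * (b - a) ^ 2 / (24 * (t : ℝ)) ≤ K * (K + 2) / (3 * (t : ℝ) * A) := by
    have e1 : Real.exp 1 * m * (b - a) ^ 2 / (24 * (t : ℝ)) = (Real.exp 1 * m * (b - a) ^ 2 / 24) / (t : ℝ) := by
      rw [div_div]
    have e2 : (K : ℝ) * (K + 2) / (3 * (t : ℝ) * A) = (K * (K + 2) / (3 * A)) / (t : ℝ) := by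
      field_simp
    rw [e1, e2]
    exact div_le_div_of_nonneg_right h2 ht.le
  linarith

end TauInt

end Summit.Ventures.LatticeQCDFlow.Scaling

end
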